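import Summits.BirchSwinnertonDyer.Rank1Residual.P2.KrizLiJZeroSetting
import Summits.BirchSwinnertonDyer.Rank1Residual.X12.CubeSumSylvesterOddPart
import Literature.NumberTheory.EllipticCurves.ComplexMultiplicationTwistIsogenyProofs
import HarnessLib

/-!
# Cell `bsd-print-cf2` (D-0131 (2) PRINT TIER, leaf CornerF @ `p = 2`), prover p3 «cube sums» — the Kriz–Li base
# `1323a1 = E₆₀₀ : y² + y = x³ + 600` IS the class of the Sylvester cube-sum curve `x³ + y³ = 7²`

HONEST FRAMING. Bookkeeping for the Kriz–Li (★)-door (aside 21366 of route PrintCf2; p3's `P2/KrizLiSmallCMBase*`,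
`P2/KrizLiCubicAThreeSlices.lean`; ty2 g3's setting `P2.cubicA₃`): no named fact, nothing asserted, two kernel
identities. Among the nine (★)-certified `j = 0` bases of conductor `< 5000` (lit DOSSIER §14.4) three are cube-sum
classes: `243a1 = x³ + y³ = 9` (p3 g2), `4563b1 ∼ x³ + y³ = 13` (p3 g3, `isIsogenous_cubeSumCurve_thirteen`) and —
here — `1323a1 = cubicA₃ 600 ∼ x³ + y³ = 49 = 7²`: `E₆₀₀ ≅ Y² = X³ + 16·(4·600 + 1) = X³ + 2⁴·7⁴` (`X = 4x`,
`Y = 8y + 4`), whose rational `3`-isogeny (Vélu, kernel `{O, (0, ±196)}`; tree `isIsogenous_mk_a₆`) lands on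
`Y² = X³ − 27·2⁴·7⁴ = X³ − 432·49²`, the tree's `cubeSumCurve 49` (`≅ X12.Sylvester.sylvesterCurve 49`). `7 ≡ 7 (mod 9)`
and `3` is a non-cube mod `7`, so `C₇` and `C₄₉` have rank one (Dasgupta–Voight 2018 Thm 1.2.1: `rk E_p = rk E_{p²} = 1`);
the certified Heegner field of `1323a1` is `ℚ(√−47)` (lit g5: `P_K = (22/9, 656/27)`, index `1`; also `−215, −479,
−503, −551`). Hence, granted the seven named facts, ty2's kernel facts for `cubicA₃ 600` (minimality, `N ∣ 1323`,
`1 ≤ rank`) and the displayed certificate, `P2.bsdp_two_of_isIsogenous_twist_cubicA₃_of_field 600 …` is `BSD(·, 2)` on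
the `ℚ`-isogeny classes of the quadratic twists `C₄₉^{(d)}`, `C₄₉^{(d·d_K)}`, `d ∈ 𝒩(1323a1, K)`. Beyond print: NO.

References: [KrizLi2019] Thm 5.1 (2), §6 Ex. 6.2; [DasguptaVoight2018] Thm 1.2.1; [CremonaAlgorithms1997] §3.8–3.9;
[Cremona1997] Table 1 (1323a1); lit DOSSIER §14.4, STATUS 2026-08-27T18:37Z.
-/

noncomputable section

open scoped Classical

open WeierstrassCurve Literature.NumberTheory.EllipticCurves Literature.NumberTheory.EllipticCurves.HuShuYin2019
  Summit.BirchSwinnertonDyer.Rank1Residual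

set_option autoImplicit false

namespace Summit.BirchSwinnertonDyer.Rank1Residual.P2

/-- The scaling `u = ½`, `t = −½` (`X = 4x`, `Y = 8y + 4`) takes `E_a` to `Y² = X³ + 16(4a+1)`; at `a = 600`:
`Y² = X³ + 38416 = X³ + 2⁴·7⁴`. [folklore] -/
theorem halfScale_smul_cubicA₃_sixHundred :
    (⟨⟨(1 / 2 : ℚ), 2, by norm_num, by norm_num⟩, 0, 0, -(1 : ℚ) / 2⟩ : VariableChange ℚ) • cubicA₃ 600 =
      ⟨0, 0, 0, 0, 38416⟩ := by
  ext <;> simp [cubicA₃, WeierstrassCurve.variableChange_a₁, WeierstrassCurve.variableChange_a₂,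
    WeierstrassCurve.variableChange_a₃, WeierstrassCurve.variableChange_a₄, WeierstrassCurve.variableChange_a₆] <;>
    norm_num

/-- **`1323a1 = E₆₀₀` is `ℚ`-ISOGENOUS to the cube-sum curve `x³ + y³ = 49`** (`cubeSumCurve 49 : y² = x³ − 432·49² =
x³ − 27·38416`, the Vélu `3`-isogeny image of `Y² = X³ + 38416 ≅ E₆₀₀`). [cite: CremonaAlgorithms1997, §3.8 and §3.9 (p. 87)]
[cite: DasguptaVoight2018, Thm. 1.2.1 (rk E_{p²} = 1 for p ≡ 4, 7 mod 9, 3 non-cube mod p)] -/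
theorem isIsogenous_cubicA₃_sixHundred_cubeSumCurve_fortyNine : IsIsogenous (cubicA₃ 600) (cubeSumCurve 49) := by
  have h49 : cubeSumCurve 49 = ⟨0, 0, 0, 0, -27 * 38416⟩ := by
    (ext <;> simp [cubeSumCurve]); norm_num
  rw [h49]
  exact (isIsogenous_of_smul_eq halfScale_smul_cubicA₃_sixHundred).trans' (isIsogenous_mk_a₆ (by norm_num))

/-- **`E₆₀₀` is `ℚ`-isogenous to the tree's integral model `X12.Sylvester.sylvesterCurve 49 = [0,0,49,0,−7·49²]` of
`x³ + y³ = 49`** (`sylvesterScale_smul 49`). [cite: CremonaAlgorithms1997, §3.8 and §3.9] -/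
theorem isIsogenous_cubicA₃_sixHundred_sylvesterCurve_fortyNine :
    IsIsogenous (cubicA₃ 600) (X12.Sylvester.sylvesterCurve 49) :=
  isIsogenous_cubicA₃_sixHundred_cubeSumCurve_fortyNine.trans'
    (by exact_mod_cast isIsogenous_of_smul_eq' (X12.Sylvester.sylvesterScale_smul 49))

/-- **`4563b1 = E₄₂` in ty2's shape is `ℚ`-ISOGENOUS to `x³ + y³ = 13`** (restatement of p3's
`isIsogenous_cubeSumCurve_thirteen` on `cubicA₃ 42`, which is `curve4563b1` by `rfl`-free rewriting of the model:
both are `[0,0,1,0,42]`). [cite: CremonaAlgorithms1997, §3.8 and §3.9] -/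
theorem isIsogenous_cubicA₃_fortyTwo_cubeSumCurve_thirteen : IsIsogenous (cubicA₃ 42) (cubeSumCurve 13) := by
  have h42 : (⟨⟨(1 / 2 : ℚ), 2, by norm_num, by norm_num⟩, 0, 0, -(1 : ℚ) / 2⟩ : VariableChange ℚ) • cubicA₃ 42 =
      ⟨0, 0, 0, 0, 2704⟩ := by
    ext <;> simp [cubicA₃, WeierstrassCurve.variableChange_a₁, WeierstrassCurve.variableChange_a₂,
      WeierstrassCurve.variableChange_a₃, WeierstrassCurve.variableChange_a₄, WeierstrassCurve.variableChange_a₆] <;>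
      norm_num
  have h13 : cubeSumCurve 13 = ⟨0, 0, 0, 0, -27 * 2704⟩ := by
    (ext <;> simp [cubeSumCurve]); norm_num
  rw [h13]
  exact (isIsogenous_of_smul_eq h42).trans' (isIsogenous_mk_a₆ (by norm_num))

end Summit.BirchSwinnertonDyer.Rank1Residual.P2

end
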